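import Mathlib.Analysis.InnerProductSpace.Spectrum
import Mathlib.Analysis.Calculus.FDeriv.Equiv
import Mathlib.LinearAlgebra.Determinant
import Literature.Analysis.FluidPDE.VectorCalculus
import HarnessLib

/-!
# Crux `PolyhedralDssProfileExists` (stmt-NavierStokesRegularity-1404), line `polyhedral_cell` —
# stub `stub_schurJet` (the Schur jet at the symmetry centre)

Let `G` be a group of linear isometries of `ℝ³ = EuclideanSpace ℝ (Fin 3)` acting irreducibly
(every `G`-invariant subspace is `⊥` or `⊤`) and let `w : ℝ³ → ℝ³` be `G`-equivariant,
`w (g x) = g (w x)`. Then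

* `w 0 = 0`: `w 0` is a `G`-fixed vector (`g 0 = 0`), the line it spans is invariant, and a line
  is neither `⊥` (unless the vector vanishes) nor `⊤` (`finrank = 3`);
* if `w` is differentiable at `0` with `div w (0) = tr Dw(0) = 0`, then `Dw(0) = 0`: the derivative
  `A = Dw(0)` commutes with `G` (chain rule), so does its adjoint (`g† = g⁻¹ ∈ G`), hence the skew
  part `K = A - A†`; `K ∘ K` is symmetric and commutes with `G`, so by the spectral theorem and
  irreducibility it is a scalar `c`; if `K ≠ 0` then `ker K = ⊥` (invariant, not `⊤`), so
  `c ‖v‖² = ⟪K K v, v⟫ = -‖K v‖² < 0`, while `0 ≤ det(K)² = det(K ∘ K) = c³ < 0` — absurd; so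
  `K = 0`, `A` is symmetric, hence a scalar `μ` (same argument), and `tr A = 3μ = 0` gives `A = 0`.

This is the real Schur lemma in odd dimension `3` (Serre, *Linear Representations of Finite
Groups*, §13.2; bib `SerreLinearRepresentations1977`) specialised to the trace-free case; all
ingredients are Mathlib
(`LinearMap.IsSymmetric.hasEigenvector_eigenvectorBasis`, `LinearMap.adjoint`, `LinearMap.det_smul`).
-/

noncomputable section

open Literature.Analysis.FluidPDE
open scoped InnerProductSpace RealInnerProductSpace

set_option linter.dupNamespace false

namespace Summit.NavierStokesRegularity.NavierStokesRegularity.Theorems.PolyhedralDssProfileExists.PolyhedralCell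

variable {G : Subgroup (EuclideanSpace ℝ (Fin 3) ≃ₗᵢ[ℝ] EuclideanSpace ℝ (Fin 3))}

/-- **A vector fixed by an irreducible group of isometries of `ℝ³` vanishes** (Schur): if every
`G`-invariant subspace of `ℝ³` is `⊥` or `⊤` and `g v = v` for all `g ∈ G`, then `v = 0` — the line
`ℝ v` is invariant and cannot be all of `ℝ³`. [folklore] -/
theorem schurJet_fixedVector_eq_zero
    (hirr : ∀ V : Submodule ℝ (EuclideanSpace ℝ (Fin 3)), (∀ g ∈ G, ∀ v ∈ V, g v ∈ V) → V = ⊥ ∨ V = ⊤)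
    {v : EuclideanSpace ℝ (Fin 3)} (hv : ∀ g ∈ G, g v = v) : v = 0 := by
  -- adapted from Cruxes/PolyhedralDssProfileExists/Lines/birth.lean (`fixedVector_eq_zero`)
  have hinv : ∀ g ∈ G, ∀ w ∈ (ℝ ∙ v), g w ∈ (ℝ ∙ v) := by
    intro g hg w hw
    obtain ⟨a, rfl⟩ := Submodule.mem_span_singleton.1 hw
    rw [map_smul, hv g hg]
    exact Submodule.smul_mem _ a (Submodule.mem_span_singleton_self v)
  rcases hirr (ℝ ∙ v) hinv with h | h
  · have hmem : v ∈ (ℝ ∙ v) := Submodule.mem_span_singleton_self v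
    rw [h] at hmem
    simpa using hmem
  · exfalso
    have h1 : Module.finrank ℝ (ℝ ∙ v) ≤ 1 := by
      simpa using finrank_span_le_card ({v} : Set (EuclideanSpace ℝ (Fin 3)))
    rw [h, finrank_top, finrank_euclideanSpace_fin] at h1
    omega

/-- **Irreducibility, pointed form**: a `G`-invariant subspace containing a nonzero vector is `⊤`.
[folklore] -/
theorem schurJet_eq_top_of_mem
    (hirr : ∀ V : Submodule ℝ (EuclideanSpace ℝ (Fin 3)), (∀ g ∈ G, ∀ v ∈ V, g v ∈ V) → V = ⊥ ∨ V = ⊤)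
    {V : Submodule ℝ (EuclideanSpace ℝ (Fin 3))} (hV : ∀ g ∈ G, ∀ v ∈ V, g v ∈ V)
    {v : EuclideanSpace ℝ (Fin 3)} (hv : v ∈ V) (hv0 : v ≠ 0) : V = ⊤ := by
  rcases hirr V hV with h | h
  · rw [h, Submodule.mem_bot] at hv
    exact absurd hv hv0
  · exact h

/-- **A symmetric operator commuting with an irreducible group of isometries of `ℝ³` is a scalar**:
by the spectral theorem it has an eigenvector; its eigenspace is `G`-invariant and nonzero, hence
all of `ℝ³`. [folklore] -/
theorem schurJet_isSymmetric_eq_smul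
    (hirr : ∀ V : Submodule ℝ (EuclideanSpace ℝ (Fin 3)), (∀ g ∈ G, ∀ v ∈ V, g v ∈ V) → V = ⊥ ∨ V = ⊤)
    {T : EuclideanSpace ℝ (Fin 3) →ₗ[ℝ] EuclideanSpace ℝ (Fin 3)} (hT : T.IsSymmetric)
    (hcomm : ∀ g ∈ G, ∀ v, T (g v) = g (T v)) : ∃ μ : ℝ, ∀ v, T v = μ • v := by
  have hn : Module.finrank ℝ (EuclideanSpace ℝ (Fin 3)) = 3 := finrank_euclideanSpace_fin
  obtain ⟨hmem, hne⟩ := hT.hasEigenvector_eigenvectorBasis hn 0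
  have hV : ∀ g ∈ G, ∀ v ∈ Module.End.eigenspace T (hT.eigenvalues hn 0 : ℝ),
      g v ∈ Module.End.eigenspace T (hT.eigenvalues hn 0 : ℝ) := by
    intro g hg v hv
    rw [Module.End.mem_eigenspace_iff] at hv ⊢
    rw [hcomm g hg v, hv, LinearIsometryEquiv.map_smul]
  have htop := schurJet_eq_top_of_mem hirr hV hmem hne
  exact ⟨_, fun v => Module.End.mem_eigenspace_iff.1 (htop ▸ Submodule.mem_top)⟩

/-- **Adjoints of intertwiners are intertwiners**: if `A` commutes with every `g ∈ G` (a group of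
isometries), so does its adjoint, since `g† = g⁻¹ ∈ G`. [folklore] -/
theorem schurJet_adjoint_comm {A : EuclideanSpace ℝ (Fin 3) →ₗ[ℝ] EuclideanSpace ℝ (Fin 3)}
    (hA : ∀ g ∈ G, ∀ v, A (g v) = g (A v)) :
    ∀ g ∈ G, ∀ v, LinearMap.adjoint A (g v) = g (LinearMap.adjoint A v) := by
  intro g hg v
  have hg' : g⁻¹ ∈ G := inv_mem hg
  have hgg : ∀ u : EuclideanSpace ℝ (Fin 3), g (g⁻¹ u) = u := fun u => by
    rw [LinearIsometryEquiv.coe_inv, LinearIsometryEquiv.apply_symm_apply]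
  refine ext_inner_right ℝ fun u => ?_
  calc ⟪LinearMap.adjoint A (g v), u⟫_ℝ = ⟪g v, A u⟫_ℝ := LinearMap.adjoint_inner_left _ _ _
    _ = ⟪g v, g (g⁻¹ (A u))⟫_ℝ := by rw [hgg]
    _ = ⟪v, g⁻¹ (A u)⟫_ℝ := g.inner_map_map _ _
    _ = ⟪v, A (g⁻¹ u)⟫_ℝ := by rw [hA g⁻¹ hg' u]
    _ = ⟪LinearMap.adjoint A v, g⁻¹ u⟫_ℝ := (LinearMap.adjoint_inner_left _ _ _).symm
    _ = ⟪g (LinearMap.adjoint A v), g (g⁻¹ u)⟫_ℝ := (g.inner_map_map _ _).symm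
    _ = ⟪g (LinearMap.adjoint A v), u⟫_ℝ := by rw [hgg]

/-- **Real Schur lemma on `ℝ³`, trace-free case**: a linear map commuting with an irreducible group
of isometries of `ℝ³` and of trace zero vanishes. The skew part `K = A - A†` commutes with `G`;
`K ∘ K` is symmetric, hence a scalar `c`; `K ≠ 0` would force `ker K = ⊥`, `c < 0` and
`0 ≤ det(K)² = c³ < 0`; so `A` is symmetric, hence a scalar `μ`, and `tr A = 3μ = 0`.
[cite: SerreLinearRepresentations1977, §13.2 (real Schur lemma)] -/
theorem schurJet_eq_zero_of_comm_of_trace_eq_zero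
    (hirr : ∀ V : Submodule ℝ (EuclideanSpace ℝ (Fin 3)), (∀ g ∈ G, ∀ v ∈ V, g v ∈ V) → V = ⊥ ∨ V = ⊤)
    {A : EuclideanSpace ℝ (Fin 3) →ₗ[ℝ] EuclideanSpace ℝ (Fin 3)}
    (hA : ∀ g ∈ G, ∀ v, A (g v) = g (A v))
    (htr : LinearMap.trace ℝ (EuclideanSpace ℝ (Fin 3)) A = 0) : A = 0 := by
  have hn : Module.finrank ℝ (EuclideanSpace ℝ (Fin 3)) = 3 := finrank_euclideanSpace_fin
  have hBc : ∀ g ∈ G, ∀ v, LinearMap.adjoint A (g v) = g (LinearMap.adjoint A v) :=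
    schurJet_adjoint_comm hA
  -- the skew part
  set K : EuclideanSpace ℝ (Fin 3) →ₗ[ℝ] EuclideanSpace ℝ (Fin 3) := A - LinearMap.adjoint A with hK
  have hKc : ∀ g ∈ G, ∀ v, K (g v) = g (K v) := by
    intro g hg v
    simp only [hK, LinearMap.sub_apply, hA g hg v, hBc g hg v, map_sub]
  have hKskew : ∀ u v, ⟪K u, v⟫_ℝ = -⟪u, K v⟫_ℝ := by
    intro u v
    simp only [hK, LinearMap.sub_apply, inner_sub_left, inner_sub_right,
      LinearMap.adjoint_inner_left, LinearMap.adjoint_inner_right]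
    ring
  have hKKsym : (K ∘ₗ K).IsSymmetric := by
    intro u v
    simp only [LinearMap.comp_apply]
    rw [hKskew (K u) v, hKskew u (K v), neg_neg]
  have hKKc : ∀ g ∈ G, ∀ v, (K ∘ₗ K) (g v) = g ((K ∘ₗ K) v) := by
    intro g hg v
    simp only [LinearMap.comp_apply, hKc g hg]
  obtain ⟨c, hc⟩ := schurJet_isSymmetric_eq_smul hirr hKKsym hKKc
  have hkerInv : ∀ g ∈ G, ∀ v ∈ LinearMap.ker K, g v ∈ LinearMap.ker K := by
    intro g hg v hv
    rw [LinearMap.mem_ker] at hv ⊢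
    rw [hKc g hg v, hv, map_zero]
  -- the skew part vanishes
  have hK0 : K = 0 := by
    rcases hirr _ hkerInv with hbot | htop
    · exfalso
      obtain ⟨v, hv⟩ := exists_ne (0 : EuclideanSpace ℝ (Fin 3))
      have hKv : K v ≠ 0 := fun h => hv (LinearMap.ker_eq_bot'.1 hbot v h)
      have hcneg : c < 0 := by
        have h1 : ⟪(K ∘ₗ K) v, v⟫_ℝ = -⟪K v, K v⟫_ℝ := by
          rw [LinearMap.comp_apply, hKskew (K v) v]
        rw [hc v, real_inner_smul_left] at h1
        have hvv : 0 < ⟪v, v⟫_ℝ := real_inner_self_pos.2 hv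
        have hKvv : 0 < ⟪K v, K v⟫_ℝ := real_inner_self_pos.2 hKv
        nlinarith
      have hKK : K ∘ₗ K = c • LinearMap.id := LinearMap.ext fun v => by simpa using hc v
      have hdet : LinearMap.det (K ∘ₗ K) = c ^ 3 := by
        rw [hKK, LinearMap.det_smul, LinearMap.det_id, hn, mul_one]
      have hsq : 0 ≤ c ^ 3 := by
        rw [← hdet, LinearMap.det_comp]
        exact mul_self_nonneg _
      have hcube : c ^ 3 < 0 := by
        have h2 : 0 < c * c := mul_pos_of_neg_of_neg hcneg hcneg
        nlinarith
      exact absurd hsq (not_le.2 hcube)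
    · exact LinearMap.ext fun v => (LinearMap.mem_ker.1 (htop ▸ Submodule.mem_top : v ∈ LinearMap.ker K))
  -- hence `A` is symmetric, hence a scalar, hence zero
  have hadj : LinearMap.adjoint A = A := by
    have h := hK0
    rw [hK, sub_eq_zero] at h
    exact h.symm
  have hAsym : A.IsSymmetric :=
    (LinearMap.isSymmetric_iff_isSelfAdjoint A).2 (LinearMap.isSelfAdjoint_iff'.2 hadj)
  obtain ⟨μ, hμ⟩ := schurJet_isSymmetric_eq_smul hirr hAsym hA
  have hAeq : A = μ • LinearMap.id := LinearMap.ext fun v => by simpa using hμ v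
  have htr' : LinearMap.trace ℝ (EuclideanSpace ℝ (Fin 3)) A = μ * 3 := by
    rw [hAeq, map_smul, LinearMap.trace_id, hn, smul_eq_mul]
    norm_num
  have hμ0 : μ = 0 := by
    rw [htr'] at htr
    linarith
  rw [hAeq, hμ0, zero_smul]

/-- **Stub D (M): the Schur jet at the centre.** If `G` acts irreducibly on `ℝ³` (every `G`-invariant
subspace is `⊥` or `⊤`) and `w : ℝ³ → ℝ³` is `G`-equivariant, then `w(0) = 0` (a `G`-fixed vector spans an
invariant line), and if moreover `w` is differentiable at `0` with `div w(0) = 0` then `Dw(0) = 0`: the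
derivative `A = Dw(0)` commutes with `G` (chain rule, `g` linear, `g 0 = 0`); its skew part `K = A - A†`
commutes with `G`, and `K ∘ K` is a symmetric intertwiner, hence a scalar `c`; `K ≠ 0` would give
`ker K = ⊥`, `c < 0` and `0 ≤ det(K)² = c³ < 0`, so `K = 0`; thus `A` is a symmetric intertwiner, hence a
scalar `μ`, and `tr A = div w(0) = 3μ = 0` forces `A = 0`. For a witness of the crux (continuous
representative) this is the thesis' `u(0,t) = 0`, `∇u(0,t) = 0`: the singular point is a degenerate
stagnation point of every slice. [cite: SerreLinearRepresentations1977, §13.2 (real Schur lemma)] -/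
theorem stub_schurJet :
    ∀ (G : Subgroup (EuclideanSpace ℝ (Fin 3) ≃ₗᵢ[ℝ] EuclideanSpace ℝ (Fin 3))),
      (∀ V : Submodule ℝ (EuclideanSpace ℝ (Fin 3)), (∀ g ∈ G, ∀ v ∈ V, g v ∈ V) → V = ⊥ ∨ V = ⊤) →
      ∀ w : EuclideanSpace ℝ (Fin 3) → EuclideanSpace ℝ (Fin 3), (∀ g ∈ G, ∀ x, w (g x) = g (w x)) →
        w 0 = 0 ∧ (DifferentiableAt ℝ w 0 → VectorCalculus.divergence w 0 = 0 → fderiv ℝ w 0 = 0) := by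
  intro G hirr w hw
  refine ⟨schurJet_fixedVector_eq_zero hirr fun g hg => by rw [← hw g hg 0, map_zero],
    fun hd hdiv => ?_⟩
  -- the derivative at the centre commutes with `G`
  have hcomm : ∀ g ∈ G, ∀ v,
      (fderiv ℝ w 0 : EuclideanSpace ℝ (Fin 3) →ₗ[ℝ] EuclideanSpace ℝ (Fin 3)) (g v) =
        g ((fderiv ℝ w 0 : EuclideanSpace ℝ (Fin 3) →ₗ[ℝ] EuclideanSpace ℝ (Fin 3)) v) := by
    intro g hg v
    have hd' : HasFDerivAt w (fderiv ℝ w 0) (g 0) := by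
      rw [map_zero]
      exact hd.hasFDerivAt
    have h1 : HasFDerivAt (w ∘ g)
        ((fderiv ℝ w 0).comp (g : EuclideanSpace ℝ (Fin 3) →L[ℝ] EuclideanSpace ℝ (Fin 3))) 0 :=
      hd'.comp 0 g.hasFDerivAt
    have h2 : HasFDerivAt (g ∘ w)
        ((g : EuclideanSpace ℝ (Fin 3) →L[ℝ] EuclideanSpace ℝ (Fin 3)).comp (fderiv ℝ w 0)) 0 :=
      g.hasFDerivAt.comp 0 hd.hasFDerivAt
    have hfg : (w ∘ g : EuclideanSpace ℝ (Fin 3) → EuclideanSpace ℝ (Fin 3)) = g ∘ w :=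
      funext (hw g hg)
    rw [hfg] at h1
    have h3 := congrArg (fun T : EuclideanSpace ℝ (Fin 3) →L[ℝ] EuclideanSpace ℝ (Fin 3) => T v)
      (h1.unique h2)
    simpa using h3
  have htr : LinearMap.trace ℝ (EuclideanSpace ℝ (Fin 3))
      (fderiv ℝ w 0 : EuclideanSpace ℝ (Fin 3) →ₗ[ℝ] EuclideanSpace ℝ (Fin 3)) = 0 := hdiv
  have h0 := schurJet_eq_zero_of_comm_of_trace_eq_zero hirr hcomm htr
  rw [← ContinuousLinearMap.coe_inj, h0, ContinuousLinearMap.toLinearMap_zero]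

end Summit.NavierStokesRegularity.NavierStokesRegularity.Theorems.PolyhedralDssProfileExists.PolyhedralCell
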